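import Literature.NumberTheory.EllipticCurves.GreenbergSelmerNewform
import Literature.NumberTheory.EllipticCurves.AnticyclotomicBigGaloisRep
import Literature.NumberTheory.GaloisRepresentations.GaloisCohomology
import HarnessLib

/-!
# The cofree module `A = T ⊗_𝒪 F/𝒪` of a framed representation is a DISCRETE `G`-MODULE
# (continuous `𝒪`-linear representation), and the big representation `M_g = T_g ⊗_𝒪 Λ_𝒪^*(Ψ⁻¹)`

Cell `bsd-stepL` (crux `stmt-BirchSwinnertonDyer-19270`, Road FF): the `g`-side instance of the
landed `AnticyclotomicBigGaloisRep κ ρ` (which asks for `ρ : ContinuousRep Γ_K 𝒪 A`, `A` discrete),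
left TODO there ("`A_g` as `ContinuousRep Γ_K 𝒪 A` … from `GreenbergSelmer.OrdinaryNewformDatum`").
The tree's `GreenbergSelmer.Cofree ρ F = Fⁿ/𝒪ⁿ` (file `GreenbergSelmerNewform`) carries the
representation `cofreeRepresentation F ρ` and the discrete topology but no continuity statement;
this file PROVES the joint continuity (open stabilisers) from the continuity of
`ρ : G →ₜ* GL_n(𝒪)`, under the one hypothesis the argument uses — every `x ∈ F` has a denominator
`d ∈ 𝒪` (`d x ∈ 𝒪`) whose ideal `d𝒪` is OPEN in `𝒪` (true for the ring of integers of a `p`-adic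
field inside its fraction field: `d = p^k`) — and packages `M_g`. Definitions with bodies and proved
theorems only; no named fact, no `sorry`, no instance.

## The argument (Serre, *Abelian ℓ-adic representations*, I §1.1–1.2; folklore)

Let `a = x mod 𝒪ⁿ ∈ A`, `x ∈ Fⁿ`, and choose denominators `d_j y_j = … `, i.e. `y_j = d_j x_j ∈ 𝒪`
with `d_j𝒪` open. The set `U = {g : (ρ(g) − 1)_{ij} ∈ d_j𝒪 ∀ i j}` is open (preimage of open
sets under the continuous matrix entries of `ρ`) and contains `1`; for `g ∈ U`,
`(ρ(g)x − x)_i = Σ_j (ρ(g) − 1)_{ij} x_j = Σ_j c_{ij} d_j x_j = Σ_j c_{ij} y_j ∈ 𝒪`, so `g · a = a`.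
Hence every stabiliser is a neighbourhood of `1` and the action on the discrete `A` is jointly
continuous (`ContinuousRep.ofStabilizerMemNhdsOne`).

## What is defined (namespace `Literature.NumberTheory.EllipticCurves.GreenbergSelmer`)

* `HasOpenDenominators 𝒪 F` — the hypothesis above (a `Prop`-valued `def` with parameters, not a
  named fact: it is an assumption on the pair `(𝒪, F)`, discharged per instance).
* `isOpen_setOf_entry_sub_mem`, `cofreeRepresentation_stabilizer_mem_nhds` — the argument.
* **`cofreeContinuousRep F ρ h : ContinuousRep G 𝒪 (Cofree ρ F)`** — `A = T ⊗ F/𝒪` as a continuous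
  representation; `cofreeContinuousRep_apply` (it is `cofreeRepresentation`, i.e. `g • a`).
* **`bigRepCofree κ ρ h`** — `M = T ⊗_𝒪 Λ_𝒪^*(Ψ⁻¹)` for a framed `ρ : Γ_K → GL_n(𝒪)` and a
  `ℤ_p`-extension `κ` of `K`: `AnticyclotomicBigGaloisRep κ (cofreeContinuousRep F ρ h)` (the
  erratum's `M_g := T_g ⊗_𝒪 Λ_𝒪^*`, `G_K` acting via `ρ_g ⊗ Ψ⁻¹`, for `ρ = ρ_g|_{Γ_K}`).

References: [Serre1968] Ch. I §1.1 (ℓ-adic representations: continuity), §1.2; [Castella2018Erratum]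
§2 (p. 2, "`M_g := T_g ⊗_𝒪 Λ_𝒪^*`, where `G_K` acts on `Λ_𝒪^*` via `Ψ⁻¹`", "`A_g := V_g/T_g`");
[EmertonPollackWeston2006] §3.1 (`A_f = K/𝒪 ⊗ T_f`); [Greenberg1989] §1 p. 98 (`A_p = V_p/T_p`).
-/

noncomputable section

open Field Topology Filter
open Literature.NumberTheory.GaloisRepresentations
open scoped MatrixGroups

namespace Literature.NumberTheory.EllipticCurves.GreenbergSelmer

section Continuity

variable {G : Type*} [Group G] [TopologicalSpace G]
variable {n : ℕ} {𝒪 : Type*} [CommRing 𝒪] [TopologicalSpace 𝒪] [IsTopologicalRing 𝒪]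
  (F : Type*) [Field F] [Algebra 𝒪 F]

/-- **Open denominators**: every `x ∈ F` has a denominator `d ∈ 𝒪` — `d • x = y` comes from `𝒪` —
whose principal ideal `d𝒪` is open in `𝒪`. For the ring of integers `𝒪` of a finite extension of
`ℚ_p` inside its field of fractions take `d = p^k` (`p^k𝒪` is an open ball). This is the only input
of the continuity argument. [cite: Serre1968, Ch. I §1.1 (the topology of `Aut(V)`, lattices `T` with `V = T ⊗ ℚ_ℓ`)] -/
def HasOpenDenominators (𝒪 F : Type*) [CommRing 𝒪] [TopologicalSpace 𝒪] [Field F] [Algebra 𝒪 F] :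
    Prop :=
  ∀ x : F, ∃ d y : 𝒪, algebraMap 𝒪 F y = algebraMap 𝒪 F d * x ∧
    IsOpen ((Ideal.span {d} : Ideal 𝒪) : Set 𝒪)

variable {F}

/-- The "congruence" set `{g : (ρ(g))_{ij} − δ_{ij} ∈ I}` is open for an open ideal `I` (continuity
of the matrix entries of `ρ : G →ₜ* GL_n(𝒪)`). [cite: Serre1968, Ch. I §1.1] -/
theorem isOpen_setOf_entry_sub_mem (ρ : FramedRep G 𝒪 n) {I : Ideal 𝒪} (hI : IsOpen (I : Set 𝒪))
    (i j : Fin n) :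
    IsOpen {g : G | ((ρ g : GL (Fin n) 𝒪) : Matrix (Fin n) (Fin n) 𝒪) i j -
      (1 : Matrix (Fin n) (Fin n) 𝒪) i j ∈ I} := by
  have hc : Continuous fun g : G =>
      ((ρ g : GL (Fin n) 𝒪) : Matrix (Fin n) (Fin n) 𝒪) i j - (1 : Matrix (Fin n) (Fin n) 𝒪) i j :=
    ((Units.continuous_val.comp ρ.continuous_toFun).matrix_elem i j).sub continuous_const
  exact hI.preimage hc

/-- **Stabilisers in `A = Fⁿ/𝒪ⁿ` are neighbourhoods of `1`** (the argument of the module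
docstring). [cite: Serre1968, Ch. I §1.1–1.2] -/
theorem cofreeRepresentation_stabilizer_mem_nhds (ρ : FramedRep G 𝒪 n) (h : HasOpenDenominators 𝒪 F)
    (a : Cofree ρ F) : {g : G | cofreeRepresentation F ρ g a = a} ∈ 𝓝 (1 : G) := by
  classical
  obtain ⟨x, rfl⟩ := cofreeMk_surjective F ρ a
  choose d y hy hd using fun j : Fin n => h (x j)
  -- the open set `U = ⋂_{i,j} {g : (ρ g − 1)_{ij} ∈ d_j 𝒪}`
  let U : Set G := ⋂ i : Fin n, ⋂ j : Fin n,
    {g : G | ((ρ g : GL (Fin n) 𝒪) : Matrix (Fin n) (Fin n) 𝒪) i j -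
      (1 : Matrix (Fin n) (Fin n) 𝒪) i j ∈ Ideal.span {d j}}
  have hU : IsOpen U :=
    isOpen_iInter_of_finite fun i => isOpen_iInter_of_finite fun j =>
      isOpen_setOf_entry_sub_mem ρ (hd j) i j
  have h1 : (1 : G) ∈ U := by
    simp only [U, Set.mem_iInter, Set.mem_setOf_eq, map_one, Units.val_one, sub_self]
    exact fun _ _ => Ideal.zero_mem _
  refine mem_of_superset (hU.mem_nhds h1) fun g hg => ?_
  simp only [U, Set.mem_iInter, Set.mem_setOf_eq] at hg
  choose c hc using fun i j => Ideal.mem_span_singleton'.1 (hg i j)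
  -- `ρ(g) x − x ∈ 𝒪ⁿ`
  change cofreeMk F ρ (fracRepresentation F ρ g x) = cofreeMk F ρ x
  refine (Submodule.Quotient.eq _).2 ((mem_lattice_iff _).2 ⟨fun i => ∑ j, c i j * y j, ?_⟩)
  ext i
  simp only [Pi.sub_apply, fracRepresentation_apply_apply, Matrix.mulVec, dotProduct,
    Matrix.map_apply, map_sum, map_mul]
  -- `x i = Σ_j δ_{ij} x_j`
  have hx : x i = ∑ j, algebraMap 𝒪 F ((1 : Matrix (Fin n) (Fin n) 𝒪) i j) * x j := by
    rw [Finset.sum_eq_single i]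
    · simp
    · intro j _ hji
      simp [Matrix.one_apply_ne (Ne.symm hji)]
    · simp
  rw [hx, ← Finset.sum_sub_distrib]
  refine Finset.sum_congr rfl fun j _ => ?_
  rw [← sub_mul, ← map_sub, ← hc i j, map_mul, mul_assoc, ← hy j]

/-- **`A = T ⊗_𝒪 F/𝒪 = Fⁿ/𝒪ⁿ` as a continuous `𝒪`-linear representation of `G`** (a discrete
`G`-module): the tree's `cofreeRepresentation F ρ` with joint continuity PROVED
(`ContinuousRep.ofStabilizerMemNhdsOne`, `cofreeRepresentation_stabilizer_mem_nhds`). For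
`ρ = ρ_g : Γ_ℚ → GL₂(𝒪)` this is the erratum's `A_g = V_g/T_g`.
[cite: Serre1968, Ch. I §1.1–1.2] [cite: Castella2018Erratum, §2 (p. 2, "`A_g := V_g/T_g`")] -/
def cofreeContinuousRep (F : Type*) [Field F] [Algebra 𝒪 F] [ContinuousMul G] (ρ : FramedRep G 𝒪 n)
    (h : HasOpenDenominators 𝒪 F) : ContinuousRep G 𝒪 (Cofree ρ F) :=
  ContinuousRep.ofStabilizerMemNhdsOne (cofreeRepresentation F ρ)
    (cofreeRepresentation_stabilizer_mem_nhds ρ h)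

/-- Unfolding: `cofreeContinuousRep F ρ h g a = g • a` (the tree's action on `Cofree ρ F`).
[cite: EmertonPollackWeston2006, §3.1] -/
@[simp] theorem cofreeContinuousRep_apply [ContinuousMul G] (ρ : FramedRep G 𝒪 n)
    (h : HasOpenDenominators 𝒪 F) (g : G) (a : Cofree ρ F) :
    cofreeContinuousRep F ρ h g a = g • a :=
  rfl

end Continuity

/-! ### `M = T ⊗_𝒪 Λ_𝒪^*(Ψ⁻¹)` for a framed `ρ : Γ_K → GL_n(𝒪)` -/

section Big

variable {K : Type} [Field K] [NumberField K] {p : ℕ} [Fact p.Prime]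
variable {n : ℕ} {𝒪 : Type*} [CommRing 𝒪] [TopologicalSpace 𝒪] [IsTopologicalRing 𝒪]
  (F : Type*) [Field F] [Algebra 𝒪 F]

/-- **`M = T ⊗_𝒪 Λ_𝒪^*(Ψ⁻¹)`** for a framed representation `ρ : Γ_K → GL_n(𝒪)` with cofree module
`A = Fⁿ/𝒪ⁿ` and a `ℤ_p`-extension `κ` of `K`: the instance `AnticyclotomicBigGaloisRep κ
(cofreeContinuousRep F ρ h)` of the landed co-induced model (smooth `A`-valued functions on `ℤ_p`,
`(g·Φ)(x) = ρ(g)Φ(x − κ g)`, `Λ_𝒪 = 𝒪⟦T⟧` through `1 + T ↦ γ`). For `ρ = ρ_g|_{Γ_K}`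
(`(Δ.ρ).comp (absGaloisRestrict ℚ K)` for a `GreenbergSelmer.OrdinaryNewformDatum Δ`) this is the
erratum's `M_g`. [cite: Castella2018Erratum, §2 (p. 2, "`M_g := T_g ⊗_𝒪 Λ_𝒪^*`, where `G_K` acts on `Λ_𝒪^*` via `Ψ⁻¹`")] -/
abbrev bigRepCofree [TopologicalSpace (PowerSeries 𝒪)] (κ : ZpExtension K p)
    (ρ : FramedRep (absoluteGaloisGroup K) 𝒪 n) (h : HasOpenDenominators 𝒪 F) :
    ContinuousRep (absoluteGaloisGroup K) (PowerSeries 𝒪) (BigRepModule 𝒪 p (Cofree ρ F)) :=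
  AnticyclotomicBigGaloisRep κ (cofreeContinuousRep F ρ h)

/-- The restriction `ρ|_{Γ_K}` of a framed representation of `Γ_ℚ` along the tree's
`absGaloisRestrict ℚ K` (the input of `bigRepCofree` for a newform datum over `ℚ`).
[cite: Castella2018Erratum, §2 (p. 2, "`ρ̄_g|_{G_K}`", "`G_K` acts")] -/
abbrev restrictFramed {G₀ : Type*} [Group G₀] [TopologicalSpace G₀]
    (ρ : FramedRep G₀ 𝒪 n) (φ : absoluteGaloisGroup K →ₜ* G₀) : FramedRep (absoluteGaloisGroup K) 𝒪 n :=
  ρ.comp φ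

end Big

end Literature.NumberTheory.EllipticCurves.GreenbergSelmer

end
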